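import Literature.AlgebraicGeometry.HodgeTheory.AbelianVarietyEndAlgebraReducedIffEndReduced
import HarnessLib

/-!
# Abelian subvarieties stable under all endomorphisms ∕ automorphisms: an abelian variety has finitely many abelian subvarieties
# iff every abelian subvariety is carried into itself by every endomorphism, iff by every automorphism
# (Lenstra–Oort–Zarhin 1996 via Zarhin 2008 Thm. 3.2; Mumford §19 Cor. 1–2)

Layer `Literature/AlgebraicGeometry/HodgeTheory`; theorems only (no `def`, no instance, no named fact; net debt 0).  Zarhin 2008
Thm. 3.2 (= Lenstra–Oort–Zarhin 1996): «the set of abelian `K`-subvarieties of `X` is finite, up to the action of `Aut(X)`».  This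
file proves the complementary dichotomy: the action is TRIVIAL (every abelian subvariety is `Aut(X)`-stable, indeed `End(X)`-stable)
exactly when the set is finite.  §1 (any field): for a `Hom`-orthogonal system `i_q : Y_q ↪ X` whose addition map is an isogeny,
every partial sum `Σ_{t ∈ T} Y_t` is carried into itself by every endomorphism of `X` (`Hom(Y_t, Y_q) = 0` for `t ≠ q`); a repeated
factor `Y_q ∼ B^ι` (`k₀ ≠ k₁`, `0 < dim B`) yields the abelian subvariety `Z = im(b_{k₀})` and the square-zero endomorphism
`φ = a_{k₀} ≫ b_{k₁}` with `φ(Z) = im(b_{k₁}) ⊄ Z`, and the unipotent AUTOMORPHISM `1 + φ` also moves `Z`; in `B ⊞ B` the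
subvariety `B × 0` is moved by `(x, y) ↦ (x, x + y)`.  §2 (perfect field): every abelian subvariety of a multiplicity-free `X` is a
partial sum, whence the equivalences.

«`φ` carries `Z` into `Z`» is recorded on closed subsets: `range (j ≫ φ) ⊆ range j` for the abelian subvariety `j : Z ↪ X`.

THE PRINT.  Zarhin, *Homomorphisms of abelian varieties over finite fields* (2008) Thm. 3.2 and §5 (pp. 7, 9), reporting Lenstra–
Oort–Zarhin, *Abelian subvarieties*, J. Algebra 180 (1996); Mumford, *Abelian Varieties* (1970) §19 Cor. 1–2 of Thm. 1 (pp. 173–174)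
and Thm. 3 (p. 176); Silverberg–Zarhin 2015 Def. 2.2–2.3 (p. 3: the isotypic components), Lemma 3.1 (p. 5).

Results (namespace `Literature.AlgebraicGeometry.HodgeTheory.AbelianVariety`):
* §1 (any field) `comp_eq_zero_of_range_subset` (`f ≫ a = 0`, `range g ⊆ range f` ⟹ `g ≫ a = 0`),
  **`range_biproduct_desc_comp_subset`** (partial sums of a `Hom`-orthogonal system are `End X`-stable),
  `range_comp_subset_of_range_eq_range_biproduct_desc`, `isIso_id_add_of_comp_self_eq_zero` (`1 + φ` is an automorphism for
  `φ² = 0`), **`exists_not_range_comp_subset_of_component`** (a repeated factor gives an abelian subvariety moved by a square-zero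
  endomorphism AND by the automorphism `1 + φ`), `not_range_inl_comp_subset` ∕ **`exists_not_range_comp_subset_biprod_self`**
  (`B × 0 ⊆ B ⊞ B` is moved by the automorphism `(x, y) ↦ (x, x + y)`);
* §2 (perfect field) **`finite_setOf_range_subvariety_iff_forall_range_comp_subset`** (finitely many abelian subvarieties ⟺ every
  abelian subvariety is stable under every endomorphism), **`finite_setOf_range_subvariety_iff_forall_range_comp_subset_of_isIso`**
  (⟺ stable under every automorphism), `forall_range_comp_subset_of_isSimple_components`.

## References
* [Zarhin2008HomomorphismsFiniteFields] Yu. G. Zarhin, *Homomorphisms of abelian varieties over finite fields* (2008)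
  (arXiv:0711.1615), Thm. 3.2 and §5 (pp. 7, 9).
* [MumfordAV1970] D. Mumford, *Abelian Varieties* (1970), §19 Thm. 1, Cor. 1–2, Thm. 3 (pp. 173–176).
* [SilverbergZarhin2015] A. Silverberg, Yu. G. Zarhin, *Isogenies of abelian varieties over finite fields* (2015)
  (arXiv:1409.0592), Def. 2.2–2.3 (p. 3), Lemma 3.1 (p. 5).
-/

noncomputable section

universe u

open CategoryTheory CategoryTheory.Limits

namespace Literature.AlgebraicGeometry.HodgeTheory

namespace AbelianVariety

open _root_.AlgebraicGeometry
open Literature.AlgebraicGeometry.Motives Literature.AlgebraicGeometry.Motives.AbelianVariety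

variable {K : Type u} [Field K]

/-! ## §1 Stable partial sums; a repeated factor gives a moved abelian subvariety (any field) -/

section AnyField

variable {X B C W : Motives.AbelianVariety K} {Q : Type} [Fintype Q] {Y : Q → Motives.AbelianVariety K}

omit [Fintype Q] in
/-- If `f ≫ a = 0` and `range g ⊆ range f` then `g ≫ a = 0`: `g` factors through the abelian subvariety `im f ↪ X`, on which `a`
vanishes (`f ↠ im f` is an epimorphism). [cite: MumfordAV1970, §19 Thm. 1 (p. 173)] -/
theorem comp_eq_zero_of_range_subset (f : B ⟶ X) {g : W ⟶ X} {a : X ⟶ C} (hfa : f ≫ a = 0)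
    (h : Set.range (Hom.toSchemeHom g) ⊆ Set.range (Hom.toSchemeHom f)) : g ≫ a = 0 := by
  obtain ⟨g', hg', -⟩ := existsUnique_hom_comp_eq_of_range_subset g (imageι f) (by rwa [range_toSchemeHom_imageι])
  haveI := epi_of_surjective_toSchemeHom (toImage f)
  have h0 : imageι f ≫ a = 0 := by
    rw [← cancel_epi (toImage f), ← Category.assoc, toImage_imageι, hfa, comp_zero]
  rw [← hg', Category.assoc, h0, comp_zero]

/-- **PARTIAL SUMS OF A `Hom`-ORTHOGONAL SYSTEM ARE STABLE UNDER EVERY ENDOMORPHISM** (any field): for abelian subvarieties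
`i_q : Y_q ↪ X` with `Hom(Y_q, Y_{q'}) = 0` (`q ≠ q'`) and `⨁ Y_q → X` an isogeny, `φ(Σ_{t ∈ T} Y_t) ⊆ Σ_{t ∈ T} Y_t` for every
`φ ∈ End X` and `T ⊆ Q`. [cite: SilverbergZarhin2015, Def. 2.2–2.3 (p. 3) and Lemma 3.1 (p. 5)] [cite: MumfordAV1970, §19 Cor. 2 of Thm. 1 (p. 174)] -/
theorem range_biproduct_desc_comp_subset (i : ∀ q, Y q ⟶ X) (hdesc : IsIsogeny (biproduct.desc i))
    (horth : ∀ q q', q ≠ q' → ∀ f : Y q ⟶ Y q', f = 0) (φ : X ⟶ X) (T : Finset Q) :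
    Set.range (Hom.toSchemeHom ((biproduct.desc fun t : T ↦ i t) ≫ φ)) ⊆
      Set.range (Hom.toSchemeHom (biproduct.desc fun t : T ↦ i t)) := by
  classical
  obtain ⟨v, m, hm, hdv, hvd⟩ := IsIsogeny.exists_nsmul_inverse_holds hdesc
  refine (range_subset_range_desc_components_iff i ((biproduct.desc fun t : T ↦ i t) ≫ φ) hdv hvd hm.ne' T).2 fun q hq ↦ ?_
  refine biproduct.hom_ext' _ _ fun t ↦ ?_
  have h0 : i t ≫ φ ≫ v ≫ biproduct.π Y q = 0 := horth t q (fun h ↦ hq (h ▸ t.2)) _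
  simp only [Category.assoc, biproduct.ι_desc_assoc, comp_zero]
  rw [show i t ≫ φ ≫ v ≫ biproduct.π Y q ≫ i q = (i t ≫ φ ≫ v ≫ biproduct.π Y q) ≫ i q by simp only [Category.assoc],
    h0, zero_comp]

/-- An abelian subvariety `j : Z ↪ X` whose closed subset is a partial sum `Σ_{t ∈ T} Y_t` is stable under every endomorphism
(any field). [cite: SilverbergZarhin2015, Def. 2.2–2.3 (p. 3)] [cite: MumfordAV1970, §19 Cor. 2 of Thm. 1 (p. 174)] -/
theorem range_comp_subset_of_range_eq_range_biproduct_desc (i : ∀ q, Y q ⟶ X) (hdesc : IsIsogeny (biproduct.desc i))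
    (horth : ∀ q q', q ≠ q' → ∀ f : Y q ⟶ Y q', f = 0) {Z : Motives.AbelianVariety K} (j : Z ⟶ X) {T : Finset Q}
    (hT : Set.range (Hom.toSchemeHom j) = Set.range (Hom.toSchemeHom (biproduct.desc fun t : T ↦ i t))) (φ : X ⟶ X) :
    Set.range (Hom.toSchemeHom (j ≫ φ)) ⊆ Set.range (Hom.toSchemeHom j) := by
  rw [range_toSchemeHom_comp_eq_image, hT, ← range_toSchemeHom_comp_eq_image]
  exact range_biproduct_desc_comp_subset i hdesc horth φ T

omit [Fintype Q] in
/-- `1 + φ` is an automorphism when `φ ≫ φ = 0` (inverse `1 - φ`). [cite: MumfordAV1970, §19 Thm. 3 (p. 176: `End X` as a ring)] -/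
theorem isIso_id_add_of_comp_self_eq_zero (φ : X ⟶ X) (h : φ ≫ φ = 0) : IsIso (𝟙 X + φ) :=
  ⟨⟨𝟙 X - φ, by rw [Preadditive.add_comp, Preadditive.comp_sub, Preadditive.comp_sub, Category.id_comp, Category.id_comp,
      Category.comp_id, h, sub_zero, sub_add_cancel],
    by rw [Preadditive.comp_add, Preadditive.sub_comp, Preadditive.sub_comp, Category.id_comp, Category.id_comp,
      Category.comp_id, h, sub_zero, sub_add_cancel]⟩⟩

/-- **A REPEATED FACTOR GIVES AN ABELIAN SUBVARIETY MOVED BY AN ENDOMORPHISM AND BY AN AUTOMORPHISM** (any field): for a member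
`Y_q ∼ B^ι` (`k₀ ≠ k₁`, `0 < dim B`) of a family of abelian subvarieties `i_q : Y_q ↪ X` with `⨁ Y_q → X` an isogeny, the abelian
subvariety `Z = im(b_{k₀})` and `φ = a_{k₀} ≫ b_{k₁}` (matrix units: `b_k ≫ a_k = M • 𝟙`, `b_k ≫ a_l = 0`) satisfy `φ ≫ φ = 0`,
`φ(Z) ⊄ Z` and `(1 + φ)(Z) ⊄ Z` (either inclusion would force `M² • 𝟙_B = 0` after composing with `a_{k₁}`).
[cite: Zarhin2008HomomorphismsFiniteFields, Thm. 3.2 and §5 (pp. 7, 9)] [cite: MumfordAV1970, §19 Cor. 2 of Thm. 1 (p. 174) and Thm. 3 (p. 176)] -/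
theorem exists_not_range_comp_subset_of_component (i : ∀ q, Y q ⟶ X) (hi : ∀ q, IsClosedImmersion (Hom.toSchemeHom (i q)))
    (hdesc : IsIsogeny (biproduct.desc i)) {q : Q} {ι : Type} [Fintype ι] (hY : IsIsogenous (Y q) (⨁ fun _ : ι ↦ B))
    {k₀ k₁ : ι} (hk : k₀ ≠ k₁) (hB : 0 < B.dim) :
    ∃ (Z : Motives.AbelianVariety K) (j : Z ⟶ X) (φ : X ⟶ X), IsClosedImmersion (Hom.toSchemeHom j) ∧ φ ≫ φ = 0 ∧
      ¬ Set.range (Hom.toSchemeHom (j ≫ φ)) ⊆ Set.range (Hom.toSchemeHom j) ∧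
      ¬ Set.range (Hom.toSchemeHom (j ≫ (𝟙 X + φ))) ⊆ Set.range (Hom.toSchemeHom j) := by
  obtain ⟨a, b, M, hM, -, hdiag, hoff⟩ := exists_matrixUnits_of_component i hi hdesc hY
  have hφφ : (a k₀ ≫ b k₁) ≫ (a k₀ ≫ b k₁) = 0 := by
    rw [Category.assoc, ← Category.assoc (b k₁) (a k₀), hoff k₁ k₀ hk.symm, zero_comp, comp_zero]
  -- ranges through `im(b_{k₀})` are ranges through `b_{k₀}`
  have hr : ∀ ψ : X ⟶ X, Set.range (Hom.toSchemeHom (imageι (b k₀) ≫ ψ)) = Set.range (Hom.toSchemeHom (b k₀ ≫ ψ)) := fun ψ ↦ by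
    rw [range_toSchemeHom_comp_eq_image, range_toSchemeHom_imageι, ← range_toSchemeHom_comp_eq_image]
  have hne : ∀ {N : ℕ}, N ≠ 0 → ∀ {g : B ⟶ X}, g ≫ a k₁ = N • 𝟙 B →
      ¬ Set.range (Hom.toSchemeHom g) ⊆ Set.range (Hom.toSchemeHom (b k₀)) := fun {N} hN {g} hg hsub ↦ by
    have h0 : g ≫ a k₁ = 0 := comp_eq_zero_of_range_subset (b k₀) (hoff k₀ k₁ hk) hsub
    rw [hg] at h0
    exact id_ne_zero_of_dim_pos hB (hom_eq_zero_of_nsmul_eq_zero hN h0)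
  refine ⟨_, imageι (b k₀), a k₀ ≫ b k₁, inferInstance, hφφ, ?_, ?_⟩
  · rw [hr, range_toSchemeHom_imageι]
    refine hne (Nat.mul_ne_zero hM hM) ?_
    simp only [Category.assoc]
    rw [← Category.assoc (b k₀) (a k₀), hdiag k₀, Preadditive.nsmul_comp, Category.id_comp, hdiag k₁, smul_smul]
  · rw [hr, range_toSchemeHom_imageι]
    refine hne (Nat.mul_ne_zero hM hM) ?_
    rw [Preadditive.comp_add, Category.comp_id, Preadditive.add_comp, hoff k₀ k₁ hk, zero_add]
    simp only [Category.assoc]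
    rw [← Category.assoc (b k₀) (a k₀), hdiag k₀, Preadditive.nsmul_comp, Category.id_comp, hdiag k₁, smul_smul]

omit [Fintype Q] in
/-- **`B × 0 ⊆ B ⊞ B` IS MOVED BY THE AUTOMORPHISM `(x, y) ↦ (x, x + y)`** and by the square-zero endomorphism `(x, y) ↦ (0, x)`
(`0 < dim B`; any field). [cite: Zarhin2008HomomorphismsFiniteFields, Thm. 3.2 and §5 (pp. 7, 9)] -/
theorem not_range_inl_comp_subset (hB : 0 < B.dim) :
    ¬ Set.range (Hom.toSchemeHom ((biprod.inl : B ⟶ B ⊞ B) ≫ (𝟙 (B ⊞ B) + biprod.fst ≫ biprod.inr))) ⊆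
        Set.range (Hom.toSchemeHom (biprod.inl : B ⟶ B ⊞ B)) ∧
      ¬ Set.range (Hom.toSchemeHom ((biprod.inl : B ⟶ B ⊞ B) ≫ biprod.fst ≫ biprod.inr)) ⊆
        Set.range (Hom.toSchemeHom (biprod.inl : B ⟶ B ⊞ B)) := by
  have hne : ∀ {g : B ⟶ B ⊞ B}, g ≫ biprod.snd = 𝟙 B →
      ¬ Set.range (Hom.toSchemeHom g) ⊆ Set.range (Hom.toSchemeHom (biprod.inl : B ⟶ B ⊞ B)) := fun {g} hg hsub ↦ by
    have h0 : g ≫ biprod.snd = 0 := comp_eq_zero_of_range_subset biprod.inl biprod.inl_snd hsub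
    rw [hg] at h0
    exact id_ne_zero_of_dim_pos hB h0
  refine ⟨hne ?_, hne ?_⟩
  · rw [Preadditive.comp_add, Category.comp_id, Preadditive.add_comp, biprod.inl_snd, zero_add, biprod.inl_fst_assoc,
      biprod.inr_snd]
  · rw [biprod.inl_fst_assoc, biprod.inr_snd]

omit [Fintype Q] in
/-- `B ⊞ B` (`0 < dim B`) has an abelian subvariety moved by an automorphism (any field). [cite: Zarhin2008HomomorphismsFiniteFields, Thm. 3.2 and §5 (pp. 7, 9)] -/
theorem exists_not_range_comp_subset_biprod_self (hB : 0 < B.dim) :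
    ∃ (Z : Motives.AbelianVariety K) (j : Z ⟶ B ⊞ B) (u : B ⊞ B ⟶ B ⊞ B), IsClosedImmersion (Hom.toSchemeHom j) ∧ IsIso u ∧
      ¬ Set.range (Hom.toSchemeHom (j ≫ u)) ⊆ Set.range (Hom.toSchemeHom j) :=
  ⟨B, biprod.inl, 𝟙 (B ⊞ B) + biprod.fst ≫ biprod.inr, isClosedImmersion_toSchemeHom_biprod_inl B B,
    isIso_id_add_of_comp_self_eq_zero _ (by rw [Category.assoc, biprod.inr_fst_assoc, zero_comp, comp_zero]),
    (not_range_inl_comp_subset hB).1⟩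

end AnyField

/-! ## §2 Over a perfect field: finitely many abelian subvarieties ⟺ all of them `End X`-stable ⟺ all `Aut X`-stable -/

section Perfect

variable [PerfectField K] {X : Motives.AbelianVariety K} {Q : Type} [Fintype Q] {Y : Q → Motives.AbelianVariety K}

/-- Every abelian subvariety of a MULTIPLICITY-FREE `X` (a `Hom`-orthogonal system of simple `i_q : Y_q ↪ X` with `⨁ Y_q → X` an
isogeny) is stable under every endomorphism (perfect field: it is a partial sum of the components).
[cite: SilverbergZarhin2015, Def. 2.2–2.3 (p. 3)] [cite: MumfordAV1970, §19 Cor. 1–2 of Thm. 1 (pp. 173–174)] -/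
theorem forall_range_comp_subset_of_isSimple_components (i : ∀ q, Y q ⟶ X)
    (hi : ∀ q, IsClosedImmersion (Hom.toSchemeHom (i q))) (hdesc : IsIsogeny (biproduct.desc i))
    (horth : ∀ q q', q ≠ q' → ∀ f : Y q ⟶ Y q', f = 0) (hYs : ∀ q, (Y q).IsSimple) {Z : Motives.AbelianVariety K}
    (j : Z ⟶ X) [IsClosedImmersion (Hom.toSchemeHom j)] (φ : X ⟶ X) :
    Set.range (Hom.toSchemeHom (j ≫ φ)) ⊆ Set.range (Hom.toSchemeHom j) := by
  obtain ⟨T, hT⟩ := exists_range_eq_range_biproduct_desc_of_isSimple_of_perfectField i hi hdesc horth hYs j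
  exact range_comp_subset_of_range_eq_range_biproduct_desc i hdesc horth j hT φ

/-- **AN ABELIAN VARIETY HAS FINITELY MANY ABELIAN SUBVARIETIES IFF EVERY ABELIAN SUBVARIETY IS STABLE UNDER EVERY ENDOMORPHISM**
(perfect field). [cite: Zarhin2008HomomorphismsFiniteFields, Thm. 3.2 and §5 (pp. 7, 9)] [cite: MumfordAV1970, §19 Cor. 1–2 of Thm. 1 (pp. 173–174)] -/
theorem finite_setOf_range_subvariety_iff_forall_range_comp_subset (X : Motives.AbelianVariety K) :
    {R : Set X.X.left | ∃ (Z : Motives.AbelianVariety K) (j : Z ⟶ X),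
        IsClosedImmersion (Hom.toSchemeHom j) ∧ R = Set.range (Hom.toSchemeHom j)}.Finite ↔
      ∀ (Z : Motives.AbelianVariety K) (j : Z ⟶ X), IsClosedImmersion (Hom.toSchemeHom j) →
        ∀ φ : X ⟶ X, Set.range (Hom.toSchemeHom (j ≫ φ)) ⊆ Set.range (Hom.toSchemeHom j) := by
  obtain ⟨r, B, n, Y, i, hB, hB0, hni, hi, hY, -, hdesc, -⟩ := exists_isotypicComponents_orthogonal X
  constructor
  · intro hfin Z j hj φ
    haveI := hj
    have h0 : ∀ q, n q = 0 := (finite_setOf_range_subvariety_iff_forall_multiplicity_eq_zero hB hB0 hni hY i hi hdesc).1 hfin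
    have hYB : ∀ q, IsIsogenous (Y q) (B q) := fun q ↦ by
      have hd : (Y q).dim = (B q).dim := by
        rw [dim_eq_mul_of_isIsogenous_biproduct_const (hY q), h0 q, zero_add, one_mul]
      exact isIsogenous_of_isIsogenous_biproduct_const_of_dim_le (hY q) (by rw [hd]; exact hB0 q) hd.le
    have horth : ∀ q q', q ≠ q' → ∀ f : Y q ⟶ Y q', f = 0 := fun q q' hqq' f ↦
      hom_eq_zero_of_isIsogenous_biproduct_const_of_ne hB hB0 hni hqq' (hY q) (hY q') f
    exact forall_range_comp_subset_of_isSimple_components i hi hdesc horth (fun q ↦ (hYB q).isSimple_symm (hB q)) j φ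
  · intro h
    by_contra hinf
    have h0 : ¬ ∀ q, n q = 0 := fun h0 ↦
      hinf ((finite_setOf_range_subvariety_iff_forall_multiplicity_eq_zero hB hB0 hni hY i hi hdesc).2 h0)
    obtain ⟨q, hq⟩ := not_forall.1 h0
    obtain ⟨Z, j, φ, hj, -, hnot, -⟩ := exists_not_range_comp_subset_of_component i hi hdesc (hY q)
      (k₀ := (⟨0, by omega⟩ : Fin (n q + 1))) (k₁ := (⟨1, by omega⟩ : Fin (n q + 1))) (Fin.ne_of_val_ne (by norm_num)) (hB0 q)
    exact hnot (h Z j hj φ)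

/-- **… IFF EVERY ABELIAN SUBVARIETY IS STABLE UNDER EVERY AUTOMORPHISM** (perfect field): the complement to «finite up to the action
of `Aut(X)`» (Lenstra–Oort–Zarhin) — the action is trivial exactly when the set is finite.
[cite: Zarhin2008HomomorphismsFiniteFields, Thm. 3.2 and §5 (pp. 7, 9)] [cite: MumfordAV1970, §19 Cor. 1–2 of Thm. 1 (pp. 173–174)] -/
theorem finite_setOf_range_subvariety_iff_forall_range_comp_subset_of_isIso (X : Motives.AbelianVariety K) :
    {R : Set X.X.left | ∃ (Z : Motives.AbelianVariety K) (j : Z ⟶ X),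
        IsClosedImmersion (Hom.toSchemeHom j) ∧ R = Set.range (Hom.toSchemeHom j)}.Finite ↔
      ∀ (Z : Motives.AbelianVariety K) (j : Z ⟶ X), IsClosedImmersion (Hom.toSchemeHom j) →
        ∀ u : X ⟶ X, IsIso u → Set.range (Hom.toSchemeHom (j ≫ u)) ⊆ Set.range (Hom.toSchemeHom j) := by
  constructor
  · intro hfin Z j hj u _
    exact (finite_setOf_range_subvariety_iff_forall_range_comp_subset X).1 hfin Z j hj u
  · intro h
    by_contra hinf
    obtain ⟨r, B, n, Y, i, hB, hB0, hni, hi, hY, -, hdesc, -⟩ := exists_isotypicComponents_orthogonal X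
    have h0 : ¬ ∀ q, n q = 0 := fun h0 ↦
      hinf ((finite_setOf_range_subvariety_iff_forall_multiplicity_eq_zero hB hB0 hni hY i hi hdesc).2 h0)
    obtain ⟨q, hq⟩ := not_forall.1 h0
    obtain ⟨Z, j, φ, hj, hφφ, -, hnot⟩ := exists_not_range_comp_subset_of_component i hi hdesc (hY q)
      (k₀ := (⟨0, by omega⟩ : Fin (n q + 1))) (k₁ := (⟨1, by omega⟩ : Fin (n q + 1))) (Fin.ne_of_val_ne (by norm_num)) (hB0 q)
    exact hnot (h Z j hj (𝟙 X + φ) (isIso_id_add_of_comp_self_eq_zero φ hφφ))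

end Perfect

end AbelianVariety

end Literature.AlgebraicGeometry.HodgeTheory

end
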